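import Literature.NumberTheory.Automorphic.UnitaryGroupArchIntegratedOperatorCasimirFamily
import Literature.NumberTheory.Automorphic.UFormGroupKBlockCasimirWeightSummable
import Literature.NumberTheory.Automorphic.U21KBlockCasimirLabelBound
import Literature.NumberTheory.Automorphic.UnitaryGroupTwoOneKTypeLabels
import HarnessLib

/-!
# V22 PAID: `(ϖ ∘ proj)(φ)` is nuclear along a Hilbert basis whenever the `K`-types of `ϖ` grow polynomially (Varadarajan §5.4 Thm. 22, in-house)

Topic `NumberTheory/Automorphic`; namespace `Literature.NumberTheory.Automorphic.UnitaryGroup` (home of the letter ★ `ArchIntegratedOperatorNuclearOfKTypeGrowth`, p829751).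
Theorems only (no definition, no named fact, no instance, no `sorry`).  Cell `hodgecm-mathlib`, line T1a `Cruxes/H413/Lines/F0_T1a_ArchCharactersLinIndep.lean`, road HC
(lead F0P3b-p01 (g2)): the DISCHARGE of the letter V22 — the last piece `hsum` of the skeleton ★ `archIntegratedOperatorNuclearOfKTypeGrowth_of_pieces` (p830248)
assembled from the `Û(2)×Û(1)` dictionary ★ `exists_kTypeLabelling` (A-p03 (g21), `UnitaryGroupTwoOneKTypeLabels`), the Casimir–label bound ★ `u21_kBlock_exists_delta_of_highestWeight` (A-p06 (g24), p830388)
and the block form of Lemma 21 ★ `summable_finrank_mul_inv_pow_casimir_of_label` (lead, p830326); `hfam` was paid in ★ `UnitaryGroupArchIntegratedOperatorCasimirFamily`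
(p830424, over A-p14 (g22)'s ★ p830250).

* `archIntegratedOperatorNuclearOfKTypeGrowth_hsum` — the `hsum` text of the skeleton, proved;
* `archIntegratedOperatorNuclearOfKTypeGrowth_holds` — **V22 at every frame**: `∀ L ι H T hT νinf, ArchIntegratedOperatorNuclearOfKTypeGrowth L ι H T hT νinf`.

With ★ C1 `archIntegratedOperatorTraceClass_forall_of_nuclearOfKTypeGrowth` (p829956) the Lines stub `stub_traceClass` (letter A5 [Knapp1986 Thm. 10.2], books #91) closes
modulo the single letter V19 ★ `IrreducibleUnitaryKTypeGrowth` [Varadarajan1989 §5.4 Thm. 19 = HarishChandra1954] (ED. 8 of the Lines file, desk pen).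
HONEST LABEL: V19 stays booked; HC_CM is proved only modulo the 2 remaining named inputs (hLiu418, h413) until rung 0 closes.

## References
* V. S. Varadarajan, *An Introduction to Harmonic Analysis on Semisimple Lie Groups* (1989), §5.4 Lemma 21, Thm. 22 (PDF pp. 159–161) [Varadarajan1989].
* A. W. Knapp, *Representation Theory of Semisimple Groups: An Overview Based on Examples* (1986), Thm. 10.2 [Knapp1986].
-/

set_option autoImplicit false

noncomputable section

open NumberField MeasureTheory CompactlySupported
-- `Classical`: the place subtypes indexing `mixedSpace L` are `Fintype` classically, as in ★ `UnitaryGroupArchCharacterTraceClass` (token-for-token binder match).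
open scoped Matrix InnerProductSpace ENNReal NNReal Classical

namespace Literature.NumberTheory.Automorphic.UnitaryGroup

open Literature.RepresentationTheory.KonnoKonno2007 Literature.RepresentationTheory.KonnoKonno2007.RealDualPair

/-- **Piece `hsum` of the V22 skeleton, PAID (Varadarajan Lemma 21 in block form for `U(2,1)`)**: for a unitary strongly continuous `ϖ` of `U(2,1)` with polynomial `K`-type
growth and every pairwise orthogonal set `S` of topologically irreducible finite-dimensional smooth closed `K`-blocks: `Σ_{W ∈ S} dim W · (1 + q_W)^{-(r+3)} < ∞`.
[cite: Varadarajan1989, §5.4 Lemma 21, proof of Thm. 22] [cite: Knapp1986, Thm. 10.2 (proof)] -/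
theorem archIntegratedOperatorNuclearOfKTypeGrowth_hsum :
    ∀ (E : Type) [NormedAddCommGroup E] [InnerProductSpace ℂ E] [CompleteSpace E]
      (ϖ : ContRepresentation ℂ (uFormGroup (Fin 2) (Fin 1)).carrier E) (_hu : ϖ.IsUnitary) (_hc : ϖ.IsStronglyContinuous),
      (∃ (c : ℝ) (r : ℕ), ∀ (W : Type) [AddCommGroup W] [Module ℂ W] [FiniteDimensional ℂ W]
          (τ : Representation ℂ (uFormGroup (Fin 2) (Fin 1)).maximalCompact W), τ.IsIrreducible →
          FiniteDimensional ℂ (Representation.homRangeSum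
              (ϖ.restrict (Subgroup.inclusion (uFormGroup (Fin 2) (Fin 1)).maximalCompact_le_carrier)).toRepresentation τ) ∧
            (Module.finrank ℂ (Representation.homRangeSum
                (ϖ.restrict (Subgroup.inclusion (uFormGroup (Fin 2) (Fin 1)).maximalCompact_le_carrier)).toRepresentation τ) : ℝ) ≤
              c * (Module.finrank ℂ W : ℝ) ^ r) →
      ∀ S : Set (ContRepresentation.ClosedSubrep (ϖ.restrict (Subgroup.inclusion (uFormGroup (Fin 2) (Fin 1)).maximalCompact_le_carrier))),
        S.Pairwise (fun W W' => W.toSubmodule ⟂ W'.toSubmodule) →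
        (∀ W ∈ S, W.toContRep.IsTopIrreducible) → (∀ W ∈ S, FiniteDimensional ℂ W.toSubmodule) →
        (∀ W ∈ S, W.toSubmodule ≤ harishChandraSpace (uFormGroup (Fin 2) (Fin 1)) ϖ) →
        ∃ n : ℕ, Summable fun W : S =>
          (Module.finrank ℂ (W : ContRepresentation.ClosedSubrep
            (ϖ.restrict (Subgroup.inclusion (uFormGroup (Fin 2) (Fin 1)).maximalCompact_le_carrier))).toSubmodule : ℝ) *
            ((1 + upqKBlockScalar ϖ (W : ContRepresentation.ClosedSubrep
              (ϖ.restrict (Subgroup.inclusion (uFormGroup (Fin 2) (Fin 1)).maximalCompact_le_carrier))).toSubmodule) ^ n)⁻¹ := by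
  intro E _ _ _ ϖ hu hc hgrowth S horth hirr hfd hsm
  obtain ⟨c, r, hgr⟩ := hgrowth
  -- the `Û(2)×Û(1)` dictionary of the blocks (A-p03)
  obtain ⟨w, -, ⟨C, hD2⟩, hD3, hD4⟩ := exists_kTypeLabelling ϖ hu hc hirr hfd
  -- the Casimir–label bound (A-p06): `(1/9)(1 + a² + b² + c²) ≤ 1 + q_W`
  obtain ⟨δ, hδ, hq⟩ := u21_kBlock_exists_delta_of_highestWeight ϖ hu hc hirr hfd hsm w hD3
  refine ⟨r + 3, summable_finrank_mul_inv_pow_casimir_of_label ϖ hgr horth hirr hfd (fun W => (((w W).1 : ℤ), (w W).2)) hδ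
    (C := C) (fun W => ?_) (fun W W' hWW' => hD4 W W' ?_) hq⟩
  · simpa only [Int.cast_natCast] using hD2 W
  · -- `(↑a, b, c) = (↑a', b', c') ⇒ (a, b, c) = (a', b', c')`
    obtain ⟨h1, h2⟩ := Prod.mk.inj hWW'
    exact Prod.ext (by exact_mod_cast h1) h2

/-- **V22 [Varadarajan1989 §5.4 Thm. 22] IS A THEOREM IN-HOUSE**: at every CM frame and Borel measure, ★ `ArchIntegratedOperatorNuclearOfKTypeGrowth L ι H T hT νinf`
(road HC of line T1a: H0–H4 by the lead, A-p14, A-p06, A-p03; letters typed by typ-T1a). [cite: Varadarajan1989, §5.4 Thm. 22] [cite: Knapp1986, Thm. 10.2] -/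
theorem archIntegratedOperatorNuclearOfKTypeGrowth_holds
    (L : Type) [Field L] [NumberField L] [IsCMField L] (ι : L →+* ℂ) (H : Matrix (Fin 3) (Fin 3) L) (T : GL (Fin 3) ℂ)
    (hT : (T : Matrix (Fin 3) (Fin 3) ℂ)ᴴ * H.map ι * (T : Matrix (Fin 3) (Fin 3) ℂ) = Literature.Geometry.ComplexHyperbolic.BallModel.J)
    (νinf : @Measure (arch (↥(maximalRealSubfield L)) L (IsCMField.complexConj L) 3 H) (borel _)) :
    ArchIntegratedOperatorNuclearOfKTypeGrowth L ι H T hT νinf :=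
  archIntegratedOperatorNuclearOfKTypeGrowth_of_hsum L ι H T hT νinf archIntegratedOperatorNuclearOfKTypeGrowth_hsum

end Literature.NumberTheory.Automorphic.UnitaryGroup

end
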